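import Literature.NumberTheory.GaloisRepresentations.AlgebraicMonodromyLie
import Literature.NumberTheory.GaloisRepresentations.GaloisRep
import HarnessLib

/-!
# `λ`-independence of the semisimple rank of the algebraic monodromy groups of a semisimple
# Serre compatible system (Hui 2013, Thm. 3.19; in the `ℚ̄_ℓ`-valued form printed as
# Böckle–Hui 2025, Thm. 2.17)

Topic `Literature/NumberTheory/GaloisRepresentations`; companion of `AlgebraicMonodromyLie.lean`
(the landed `semisimpleRankOf F n G = rank 𝔤 - dim 𝔷(𝔤)`, `𝔤 = Lie(Ḡ) ⊆ 𝔤𝔩ₙ`, of a subgroup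
`G ≤ GL_n(F)`, with its invariances `semisimpleRankOf_zariskiClosure`, `_eq_of_finiteIndex`,
`_map_conj`, `_map_ringEquiv`).  Requested by the cite items wi-39935 (typed shape
`HuiCompatibleSemisimpleRank`, line `clifford-gabber-hui` of crux `PrimeRankTransport`, route
`Langlands/OrdinaryPrimeTransport`) and wi-38102 (typed shape `Hui2013SemisimpleRank`, region
skeleton `prime-rank-transport` of crux `IrreducibleOffSector`, route
`Langlands/IrreducibilityBySelfDuality`; the same statement with an extra `E_λ`-model clause).

## Sources and what is printed (held texts `paper:arxiv-1204.5271`, `paper:arxiv-2208.04002`,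
## `paper:arxiv-2404.08954`, read)

* C.-Y. Hui, *Monodromy of Galois representations and equal-rank subalgebra equivalence*, Math.
  Res. Lett. 20 (2013) 705–725 = arXiv:1204.5271 [Hui2013MRL].  §3 follows Serre, *Abelian
  `ℓ`-adic representations* [SerreAbelianLadic1968, Ch. I §2.3]: `ρ : G_K → GL_n(ℚ_ℓ)` is *rational*
  if outside a finite `S ⊂ Σ_K` it is unramified with `P_{v,ρ}(T) = det(1 - F_{v,ρ} T) ∈ ℚ[T]`
  (Def. 3.3); two rational representations are *compatible* if outside a finite `S` both are
  unramified with `P_{v,ρ} = P_{v,ρ'}` (Def. 3.4); a system `{ρ_ℓ}_{ℓ ∈ 𝒫}` indexed by ALL primes is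
  compatible if its members are pairwise compatible (Def. 3.5).  **Theorem 3.19** (arXiv p. 13):
  "Let `{ρ_ℓ}_{ℓ∈𝒫}` be a semisimple, compatible system of `ℓ`-adic representations of a number
  field `K`, `ρ_ℓ : G_K → GL_n(ℚ_ℓ)`.  Let `T_ℓ` be a maximal torus of `G_ℓ°` … Then the triple
  `(([G_ℓ°, G_ℓ°] ∩ T_ℓ)°, T_ℓ, Φ_ℓ)` is independent of `ℓ`.  Therefore, the formal character of
  the tautological representation `(G_ℓ°)^der ↪ GL_{n,ℚ_ℓ}` and hence the semisimple rank of `G_ℓ°`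
  are independent of `ℓ`."  (`G_ℓ` = the Zariski closure of `ρ_ℓ(G_K)`, the algebraic monodromy
  group, §1; it is reductive for semisimple `ρ_ℓ`.)  **Remark 3.22** (arXiv p. 15): "Let `{ρ_λ}`
  be a compatible system of semisimple, `E_λ`-adic representations of `G_K` [Serre3]. … one can
  prove that Proposition 3.18, Theorem 3.19, and Theorem 3.21 are also true in `E_λ`-adic case
  using identical arguments."
* G. Böckle, C.-Y. Hui, *Weak abelian direct summands and irreducibility of Galois
  representations*, Math. Ann. 393 (2025) 543–569 = arXiv:2404.08954 [BockleHui2025].  **§2.2**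
  (arXiv p. 5): "Let `S ⊂ Σ_K` a finite subset and `E` a number field.  For `λ ∈ Σ_E`, denote its
  residue characteristic by `ℓ(λ)` (and so that `Ē_λ ≅ ℚ̄_{ℓ(λ)}`).  A family of `n`-dimensional
  `ℓ`-adic representations (indexed by `Σ_E`) `{ρ_λ : Gal_K → GL_n(Ē_λ) : λ ∈ Σ_E}` is said to be
  a Serre compatible system (SCS) of `K` defined over `E` unramified outside `S` ([Se98]) if there
  exists `P_v(T) ∈ E[T]` for all `v ∈ Σ_K ∖ S` such that for any `λ ∈ Σ_E` and
  `v ∈ Σ_K ∖ (S ∪ S_{ℓ(λ)})`, the representation `ρ_λ` is unramified at `v` and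
  `det(ρ_λ(Frob_v) - T·Id) = P_v(T) ∈ E[T]`.  The compatible system is said to be semisimple if
  `ρ_λ` is semisimple for all `λ`."  **§2.9** (arXiv p. 11), under the standing hypothesis "Let
  `{ρ_λ : Gal_K → GL_n(Ē_λ)}` be a semisimple Serre compatible system of `K` defined over `E`
  unramified outside a finite `S ⊂ Σ_K`.  Let `G_λ` be the algebraic monodromy group of `ρ_λ`":
  **Theorem 2.17 (Hu13).** "The formal bi-character of `G_λ` is independent of `λ`.  In
  particular, the formal character of `G_λ` (resp. `G_λ^der`) is independent of `λ`."  (§2.5: the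
  formal character of a reductive `G ⊂ GL_{n,F}`, `F` algebraically closed, is a maximal torus
  `T ⊂ GL_{n,F}` up to conjugation; "the same" across fields means "admit the same `ℤ`-form
  `T_ℤ ⊂ 𝔾_{m,ℤ}ⁿ`" — in particular the same dimension.)  **§3.1** (arXiv p. 13) gives the
  `(ℓ, ι)`-reparametrisation used below: "Any field isomorphism `ι : ℂ → ℚ̄_ℓ` induces a finite
  place `λ ∈ Σ_E` dividing `ℓ`, so that `ℚ̄_ℓ` can be identified as `Ē_λ` … Hence, the set
  `{ρ_{π,ι} : ι : ℂ → ℚ̄_ℓ, ℓ rational prime}` … is equal to the family `{ρ_λ : λ ∈ Σ_E}`, which … is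
  a semisimple Serre compatible system of `K` defined over `E`."
* C.-Y. Hui, *Monodromy of subrepresentations and irreducibility of low degree automorphic Galois
  representations*, J. London Math. Soc. 108 (2023) 2436–2490 = arXiv:2208.04002 [Hui2023],
  **Theorem 2.7 (Hu13)** (arXiv p. 9): "Let `{ρ_λ}_λ` be a SCS or WCS.  The formal bi-character of
  `G_λ ⊂ GL_n` is independent of `λ`" (there SCS = `E_λ`-valued, §2.4.2; WCS = `Ē_λ`-valued with
  the de Rham / Hodge–Tate clauses of [BLGGT14], §2.4.3; §2.3: formal (bi-)characters of `G` are
  those of `G°`, over `F̄`).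

## What is vendored, and faithfulness

ONE named fact (D-0014), `Hui2013_semisimpleRank_independence`: the SEMISIMPLE-RANK consequence of
[BockleHui2025, Thm. 2.17] = [Hui2013MRL, Thm. 3.19 + Rem. 3.22] for semisimple Serre compatible
systems in the `Ē_λ = ℚ̄_ℓ`-valued sense of [BockleHui2025, §2.2], in the `(ℓ, ι)`-coordinates of
the consumers and over the landed `semisimpleRankOf`.  It is VERBATIM the line Prop
`HuiCompatibleSemisimpleRank` (wi-39935) with `ssRank` / `subfieldEmb` unfolded:

* MEMBERS.  `r ℓ ι : Γ_K →ₜ* GL_n(ℚ̄_ℓ)` (`FramedGaloisRep K (PadicAlgCl ℓ) n`) for every prime `ℓ`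
  and every field isomorphism `ι : ℚ̄_ℓ ≃+* ℂ`, each SEMISIMPLE (`toGaloisRep.IsSemisimple`);
  `E ⊂ ℂ` a number field (`Subfield ℂ`, finite over `ℚ`), read in `ℚ̄_ℓ` through `ι⁻¹|_E`.
  NO `E_λ`-model clause and NO Hodge-theoretic clause: [BockleHui2025, §2.2] has neither (members
  `Gal_K → GL_n(Ē_λ)`); the `E_λ`-valued case ([Hui2013MRL, Rem. 3.22], [Hui2023, §2.4.2]) is the
  proved corollary `Hui2013_semisimpleRank_independence.of_models` (wi-38102's shape).
* `E`-RATIONALITY AND COMPATIBILITY with ONE finite exceptional set: for all `v` in a cofinite set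
  (`∀ᶠ v in cofinite`, i.e. `v ∉ S`, `S` finite) there is ONE `Q_v ∈ E[X]` such that every member
  with `v ∤ ℓ` (`(ℓ : 𝓞 K) ∉ v`) is unramified at `v` (`IsUnramifiedAt`) with arithmetic-Frobenius
  characteristic polynomial `ι⁻¹(Q_v)` (`HasFrobCharpolyAt`, `det(X·Id - ρ(Frob_v))`;
  [BockleHui2025]'s `det(ρ(Frob_v) - T·Id)` is `(-1)ⁿ` times it and Serre's `det(1 - F T)` its
  reciprocal, so "coefficients in `E`, the same for all `λ`" is the same condition) — exactly the
  condition of §2.2.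
* CONCLUSION.  All `semisimpleRankOf ℚ̄_ℓ (Fin n) (range (r ℓ ι))` are equal — the semisimple rank
  of (the Zariski closure `G_λ` of) the image: `rank 𝔤 - dim 𝔷(𝔤)` for `𝔤 = Lie(G_λ) = Lie(G_λ°)`,
  which for the REDUCTIVE `G_λ°` of a semisimple `ρ_λ` is the rank of `[𝔤, 𝔤] = Lie((G_λ°)^der)`,
  i.e. the dimension of the torus `T^ss` of the formal bi-character [Hui2013MRL, (3.20)]; printed:
  "the formal character of `G_λ^der` is independent of `λ`" (Thm. 2.17), "hence the semisimple
  rank of `G_ℓ°` [is] independent of `ℓ`" (Thm. 3.19).  WEAKER than the sources (only a numerical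
  shadow of the bi-character is kept; the tree has no maximal tori of algebraic monodromy groups).
* INDEXING (the only reparametrisation, the one of [BockleHui2025, §3.1]).  The printed systems are
  indexed by the finite places `λ` of `E`, one member per `λ`; the typed family by `(ℓ, ι)`.  Every
  `λ ∣ ℓ` is induced by some `ι` (an embedding `E ↪ ℚ̄_ℓ` over `λ` extends to a field isomorphism
  `ℂ ≃ ℚ̄_ℓ`, both fields being algebraically closed of characteristic `0` and of the same
  uncountable cardinality), so choosing one `ι_λ` per `λ` extracts from the typed family an honest
  semisimple SCS `{r ℓ ι_λ}_λ` over `E` in the sense of §2.2 (same `S`, same `P_v = Q_v`), to which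
  the theorem applies; two arbitrary indices `(ℓ₁, ι₁)`, `(ℓ₂, ι₂)` either induce different
  places — and then lie in a common selection — or are both compared with any member at a third
  prime.  No density or Brauer–Nesbitt argument is hidden in the reindexing.

## References

* [BockleHui2025] G. Böckle, C.-Y. Hui, Math. Ann. 393 (2025) 543–569 = arXiv:2404.08954: §2.2
  (SCS, `Ē_λ`-valued; p. 5), §2.5 (formal character; p. 6), §2.9 Thm. 2.17 (p. 11), §3.1 (p. 13).
* [Hui2013MRL] C.-Y. Hui, Math. Res. Lett. 20 (2013) 705–725 = arXiv:1204.5271: Defs. 3.3–3.5,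
  Thm. 3.19 (p. 13), (3.20), Rem. 3.22 (p. 15).
* [Hui2023] C.-Y. Hui, J. London Math. Soc. 108 (2023) 2436–2490 = arXiv:2208.04002: §2.3,
  §2.4.2–2.4.3 (p. 7), Thm. 2.7 (p. 9).
* [SerreAbelianLadic1968] J.-P. Serre, *Abelian `ℓ`-adic representations and elliptic curves*
  (1968), Ch. I §2.3 (rational, compatible, `E_λ`-adic systems).
-/

noncomputable section

open scoped NumberField
open NumberField IsDedekindDomain Filter

namespace Literature.NumberTheory.GaloisRepresentations

/-- **Hui 2013, Thm. 3.19 (`ℚ̄_ℓ`-valued form: Böckle–Hui 2025, Thm. 2.17): the semisimple rank of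
the algebraic monodromy group of a semisimple Serre compatible system is independent of `λ`.**
Let `K` be a number field, `E ⊂ ℂ` a number field, and `r ℓ ι : Γ_K →ₜ* GL_n(ℚ̄_ℓ)` a family of
continuous representations indexed by the primes `ℓ` and the field isomorphisms `ι : ℚ̄_ℓ ≃ ℂ`
such that (a) every `r ℓ ι` is SEMISIMPLE and (b) off ONE finite set of places `v` of `K` there is
a polynomial `Q_v ∈ E[X]` which is the arithmetic-Frobenius characteristic polynomial at `v` —
read in `ℚ̄_ℓ[X]` through `ι⁻¹|_E` — of every member with `v ∤ ℓ`, that member being unramified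
at `v` (a semisimple Serre compatible system of `K` defined over `E`,
`{ρ_λ : Gal_K → GL_n(Ē_λ)}_λ`, [BockleHui2025, §2.2]).  Then the semisimple rank
`semisimpleRankOf ℚ̄_ℓ (Fin n) (range (r ℓ ι))` of (the Zariski closure `G_λ` of) the image —
`rank 𝔤 - dim 𝔷(𝔤)`, `𝔤 = Lie(G_λ)`, the rank of `Lie((G_λ°)^der)` for the reductive `G_λ°`
[Hui2013MRL, (3.20)] — is the same for all `(ℓ, ι)`.  Printed for systems indexed by the places
`λ` of `E`: "The formal bi-character of `G_λ` is independent of `λ`.  In particular, the formal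
character of `G_λ` (resp. `G_λ^der`) is independent of `λ`" [BockleHui2025, Thm. 2.17 (Hu13)],
"… and hence the semisimple rank of `G_ℓ°` [is] independent of `ℓ`" [Hui2013MRL, Thm. 3.19;
`E_λ`-adic case Rem. 3.22]; the `(ℓ, ι)`-indexing is the reparametrisation of
[BockleHui2025, §3.1] explained in the module docstring (one `ι` per `λ` is a printed system).
VERBATIM the line Prop `HuiCompatibleSemisimpleRank` of crux `PrimeRankTransport` (wi-39935) with
`ssRank` / `subfieldEmb` unfolded.  Weaker than the sources (semisimple rank only).  Named fact
(D-0014); users take `(h : Hui2013_semisimpleRank_independence)`.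
[cite: BockleHui2025, Thm. 2.17 and §2.2] [cite: Hui2013MRL, Thm. 3.19 and Rem. 3.22]
[cite: Hui2023, Thm. 2.7] -/
def Hui2013_semisimpleRank_independence : Prop :=
  ∀ (K : Type) [Field K] [NumberField K] (n : ℕ) (E : Subfield ℂ), FiniteDimensional ℚ E →
    ∀ r : ∀ (ℓ : ℕ) [Fact ℓ.Prime], (PadicAlgCl ℓ ≃+* ℂ) → FramedGaloisRep K (PadicAlgCl ℓ) n,
      (∀ (ℓ : ℕ) [Fact ℓ.Prime] (ι : PadicAlgCl ℓ ≃+* ℂ), (r ℓ ι).toGaloisRep.IsSemisimple) →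
      (∀ᶠ v : HeightOneSpectrum (𝓞 K) in cofinite, ∃ Q : Polynomial E,
          ∀ (ℓ : ℕ) [Fact ℓ.Prime] (ι : PadicAlgCl ℓ ≃+* ℂ), ((ℓ : ℕ) : 𝓞 K) ∉ v.asIdeal →
            (r ℓ ι).IsUnramifiedAt v ∧
              (r ℓ ι).HasFrobCharpolyAt v
                (Q.map ((ι.symm : ℂ ≃+* PadicAlgCl ℓ).toRingHom.comp E.subtype))) →
      ∀ (ℓ₁ : ℕ) [Fact ℓ₁.Prime] (ι₁ : PadicAlgCl ℓ₁ ≃+* ℂ) (ℓ₂ : ℕ) [Fact ℓ₂.Prime]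
        (ι₂ : PadicAlgCl ℓ₂ ≃+* ℂ),
        semisimpleRankOf (PadicAlgCl ℓ₁) (Fin n) (r ℓ₁ ι₁).toMonoidHom.range =
          semisimpleRankOf (PadicAlgCl ℓ₂) (Fin n) (r ℓ₂ ι₂).toMonoidHom.range

namespace Hui2013_semisimpleRank_independence

variable {K : Type} [Field K] [NumberField K] {n : ℕ} {E : Subfield ℂ}
  {r : ∀ (ℓ : ℕ) [Fact ℓ.Prime], (PadicAlgCl ℓ ≃+* ℂ) → FramedGaloisRep K (PadicAlgCl ℓ) n}

/-- Hypothesis form of `Hui2013_semisimpleRank_independence`: given the fact, the semisimple ranks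
of the images of any two members of a semisimple `E`-rational compatible family agree.
[cite: BockleHui2025, Thm. 2.17] -/
theorem apply (h : Hui2013_semisimpleRank_independence) (hE : FiniteDimensional ℚ E)
    (hss : ∀ (ℓ : ℕ) [Fact ℓ.Prime] (ι : PadicAlgCl ℓ ≃+* ℂ), (r ℓ ι).toGaloisRep.IsSemisimple)
    (hcompat : ∀ᶠ v : HeightOneSpectrum (𝓞 K) in cofinite, ∃ Q : Polynomial E,
      ∀ (ℓ : ℕ) [Fact ℓ.Prime] (ι : PadicAlgCl ℓ ≃+* ℂ), ((ℓ : ℕ) : 𝓞 K) ∉ v.asIdeal →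
        (r ℓ ι).IsUnramifiedAt v ∧
          (r ℓ ι).HasFrobCharpolyAt v
            (Q.map ((ι.symm : ℂ ≃+* PadicAlgCl ℓ).toRingHom.comp E.subtype)))
    (ℓ₁ : ℕ) [Fact ℓ₁.Prime] (ι₁ : PadicAlgCl ℓ₁ ≃+* ℂ) (ℓ₂ : ℕ) [Fact ℓ₂.Prime]
    (ι₂ : PadicAlgCl ℓ₂ ≃+* ℂ) :
    semisimpleRankOf (PadicAlgCl ℓ₁) (Fin n) (r ℓ₁ ι₁).toMonoidHom.range =
      semisimpleRankOf (PadicAlgCl ℓ₂) (Fin n) (r ℓ₂ ι₂).toMonoidHom.range :=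
  h K n E hE r hss hcompat ℓ₁ ι₁ ℓ₂ ι₂

/-- **The `E_λ`-valued case** ([Hui2013MRL, Rem. 3.22]: "a compatible system of semisimple,
`E_λ`-adic representations"; [Hui2023, §2.4.2]: SCS members `Gal_K → GL_n(E_λ)`): the same
conclusion for families whose members moreover have ALL their matrix entries in the closure of
`ι⁻¹(E)` in `ℚ̄_ℓ` (`= E_λ` for the place `λ ∣ ℓ` induced by `ι⁻¹`) — the region-skeleton Prop
`Hui2013SemisimpleRank` of crux `IrreducibleOffSector` (wi-38102) with `subfieldEmb` unfolded and the
landed `Subgroup`-valued `semisimpleRankOf` in place of the skeleton's interim `Set`-valued one.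
Immediate from the fact by forgetting the model clause.
[cite: Hui2013MRL, Thm. 3.19 and Rem. 3.22] [cite: BockleHui2025, Thm. 2.17] -/
theorem of_models (h : Hui2013_semisimpleRank_independence) :
    ∀ (K : Type) [Field K] [NumberField K] (n : ℕ) (E : Subfield ℂ), FiniteDimensional ℚ E →
      ∀ r : ∀ (ℓ : ℕ) [Fact ℓ.Prime], (PadicAlgCl ℓ ≃+* ℂ) → FramedGaloisRep K (PadicAlgCl ℓ) n,
        (∀ (ℓ : ℕ) [Fact ℓ.Prime] (ι : PadicAlgCl ℓ ≃+* ℂ), (r ℓ ι).toGaloisRep.IsSemisimple ∧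
            ∀ (g : Field.absoluteGaloisGroup K) (i j : Fin n),
              ((r ℓ ι g : GL (Fin n) (PadicAlgCl ℓ)) : Matrix (Fin n) (Fin n) (PadicAlgCl ℓ)) i j ∈
                closure (Set.range ((ι.symm : ℂ ≃+* PadicAlgCl ℓ).toRingHom.comp E.subtype))) →
        (∀ᶠ v : HeightOneSpectrum (𝓞 K) in cofinite, ∃ Q : Polynomial E,
            ∀ (ℓ : ℕ) [Fact ℓ.Prime] (ι : PadicAlgCl ℓ ≃+* ℂ), ((ℓ : ℕ) : 𝓞 K) ∉ v.asIdeal →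
              (r ℓ ι).IsUnramifiedAt v ∧
                (r ℓ ι).HasFrobCharpolyAt v
                  (Q.map ((ι.symm : ℂ ≃+* PadicAlgCl ℓ).toRingHom.comp E.subtype))) →
        ∀ (ℓ₁ : ℕ) [Fact ℓ₁.Prime] (ι₁ : PadicAlgCl ℓ₁ ≃+* ℂ) (ℓ₂ : ℕ) [Fact ℓ₂.Prime]
          (ι₂ : PadicAlgCl ℓ₂ ≃+* ℂ),
          semisimpleRankOf (PadicAlgCl ℓ₁) (Fin n) (r ℓ₁ ι₁).toMonoidHom.range =
            semisimpleRankOf (PadicAlgCl ℓ₂) (Fin n) (r ℓ₂ ι₂).toMonoidHom.range :=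
  fun K _ _ n E hE r hmem hcompat ℓ₁ _ ι₁ ℓ₂ _ ι₂ =>
    h K n E hE r (fun ℓ _ ι => (hmem ℓ ι).1) hcompat ℓ₁ ι₁ ℓ₂ ι₂

/-- The same conclusion for the ALGEBRAIC MONODROMY GROUPS themselves, i.e. the Zariski closures
`G_λ = Zar(r(Γ_K)) ≤ GL_n(ℚ̄_ℓ)` of the images (`zariskiClosure`; `Lie(Ḡ) = Lie(G)`,
`semisimpleRankOf_zariskiClosure`). [cite: BockleHui2025, Thm. 2.17] -/
theorem zariskiClosure (h : Hui2013_semisimpleRank_independence) (hE : FiniteDimensional ℚ E)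
    (hss : ∀ (ℓ : ℕ) [Fact ℓ.Prime] (ι : PadicAlgCl ℓ ≃+* ℂ), (r ℓ ι).toGaloisRep.IsSemisimple)
    (hcompat : ∀ᶠ v : HeightOneSpectrum (𝓞 K) in cofinite, ∃ Q : Polynomial E,
      ∀ (ℓ : ℕ) [Fact ℓ.Prime] (ι : PadicAlgCl ℓ ≃+* ℂ), ((ℓ : ℕ) : 𝓞 K) ∉ v.asIdeal →
        (r ℓ ι).IsUnramifiedAt v ∧
          (r ℓ ι).HasFrobCharpolyAt v
            (Q.map ((ι.symm : ℂ ≃+* PadicAlgCl ℓ).toRingHom.comp E.subtype)))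
    (ℓ₁ : ℕ) [Fact ℓ₁.Prime] (ι₁ : PadicAlgCl ℓ₁ ≃+* ℂ) (ℓ₂ : ℕ) [Fact ℓ₂.Prime]
    (ι₂ : PadicAlgCl ℓ₂ ≃+* ℂ) :
    semisimpleRankOf (PadicAlgCl ℓ₁) (Fin n)
        (Literature.NumberTheory.Automorphic.zariskiClosure (r ℓ₁ ι₁).toMonoidHom.range) =
      semisimpleRankOf (PadicAlgCl ℓ₂) (Fin n)
        (Literature.NumberTheory.Automorphic.zariskiClosure (r ℓ₂ ι₂).toMonoidHom.range) := by
  rw [semisimpleRankOf_zariskiClosure, semisimpleRankOf_zariskiClosure]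
  exact h K n E hE r hss hcompat ℓ₁ ι₁ ℓ₂ ι₂

/-- The conclusion is insensitive to a change of frame of any member: conjugating `r ℓ₂ ι₂` by
`P ∈ GL_n(ℚ̄_ℓ₂)` (`FramedRep.conj`, image `P · range · P⁻¹`) does not change its semisimple rank
(`semisimpleRankOf_map_conj`), so the fact compares a member with any conjugate of another — e.g.
with an equivalent representation. [cite: BockleHui2025, Thm. 2.17] -/
theorem conj (h : Hui2013_semisimpleRank_independence) (hE : FiniteDimensional ℚ E)
    (hss : ∀ (ℓ : ℕ) [Fact ℓ.Prime] (ι : PadicAlgCl ℓ ≃+* ℂ), (r ℓ ι).toGaloisRep.IsSemisimple)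
    (hcompat : ∀ᶠ v : HeightOneSpectrum (𝓞 K) in cofinite, ∃ Q : Polynomial E,
      ∀ (ℓ : ℕ) [Fact ℓ.Prime] (ι : PadicAlgCl ℓ ≃+* ℂ), ((ℓ : ℕ) : 𝓞 K) ∉ v.asIdeal →
        (r ℓ ι).IsUnramifiedAt v ∧
          (r ℓ ι).HasFrobCharpolyAt v
            (Q.map ((ι.symm : ℂ ≃+* PadicAlgCl ℓ).toRingHom.comp E.subtype)))
    (ℓ₁ : ℕ) [Fact ℓ₁.Prime] (ι₁ : PadicAlgCl ℓ₁ ≃+* ℂ) (ℓ₂ : ℕ) [Fact ℓ₂.Prime]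
    (ι₂ : PadicAlgCl ℓ₂ ≃+* ℂ) (P : GL (Fin n) (PadicAlgCl ℓ₂)) :
    semisimpleRankOf (PadicAlgCl ℓ₁) (Fin n) (r ℓ₁ ι₁).toMonoidHom.range =
      semisimpleRankOf (PadicAlgCl ℓ₂) (Fin n) (FramedRep.conj P (r ℓ₂ ι₂)).toMonoidHom.range := by
  have hrange : (FramedRep.conj P (r ℓ₂ ι₂)).toMonoidHom.range =
      ((r ℓ₂ ι₂).toMonoidHom.range).map (MulAut.conj P : GL (Fin n) (PadicAlgCl ℓ₂) →* _) := by
    ext g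
    simp only [MonoidHom.mem_range, Subgroup.mem_map]
    constructor
    · rintro ⟨σ, rfl⟩
      exact ⟨r ℓ₂ ι₂ σ, ⟨σ, rfl⟩, (FramedRep.conj_apply P (r ℓ₂ ι₂) σ).symm⟩
    · rintro ⟨x, ⟨σ, rfl⟩, rfl⟩
      exact ⟨σ, FramedRep.conj_apply P (r ℓ₂ ι₂) σ⟩
  rw [hrange, semisimpleRankOf_map_conj]
  exact h K n E hE r hss hcompat ℓ₁ ι₁ ℓ₂ ι₂

end Hui2013_semisimpleRank_independence

end Literature.NumberTheory.GaloisRepresentations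

end
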